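import Literature.Analysis.FluidPDE.NSGalerkinStationary

/-!
# Route WindLine — support item `WindLineReachesCalm` (stmt-AnomalousDissipation-11420), II:
# the windy Galerkin phase space — the mean mode, the energy identity in coordinates, coercivity

Helper file (no route declaration is asserted here). For a finite symmetric frequency set `S ∋ 0`,
a real solenoidal force vector `g` with NO MEAN MODE (`g 0 = 0`) and a state `c` in the Galerkin phase
space `galerkinSubspace S` (real, transversal coefficient vectors on `S`, mean mode INCLUDED — the
momentum `c 0` is a free real vector, the "wind"):

* `convectionCoeff_apply_zero` — the convection symbol has no mean mode on transversal families
  (`∑_{l+m=0} 2πi (c_l · m) c'_m = 0` since `c_{-m} · m = 0`), hence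
  `galerkinRHS_apply_zero`: the Galerkin field `galerkinRHS S ν g c` vanishes at `k = 0` — the momentum
  is conserved, the windy steady states are the zeros of the tree's own `galerkinRHS` on the full ball.
* `sum_re_inner_galerkinRHS_eq` — the energy identity in coordinates,
  `∑_k Re⟪c_k, V(c)_k⟫ = -ν·4π² ∑_k |k|² ‖c_k‖² + ∑_k Re⟪g_k, c_k⟫` (the wind does no work).
* `sum_re_inner_galerkinRHS_le` — COERCIVITY off the mean mode:
  `∑_k Re⟪c_k, V(c)_k⟫ ≤ -4π²ν β + ‖g‖₂ √β`, `β = ∑_{k ≠ 0} ‖c_k‖²`, uniformly in the wind `c 0`.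
* `sqrt_calmEnergy_le_of_galerkinRHS_eq_zero`, `norm_apply_le_of_galerkinRHS_eq_zero` — the a-priori bound
  at a windy steady state: `√β ≤ ‖g‖₂ / (4π²ν)`, so `‖c_k‖ ≤ ‖g‖₂ / (4π²ν)` for every `k ≠ 0`, whatever the wind.

Sources: R. Temam, *Navier–Stokes Equations* (1979), Ch. II (1.29)–(1.30) (energy equation and a-priori
bound of the Galerkin approximations; tree: `NSGalerkinStationary`); the bookkeeping of the mean mode is folklore.
-/

-- `Summit.<Summit>.<Problem>` is the tree's mandated summit-side namespace (CONVENTIONS §2); for this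
-- single-conjunct summit the two coincide, so the duplicate is deliberate.
set_option linter.dupNamespace false

noncomputable section

open scoped BigOperators InnerProductSpace ComplexConjugate
open Set Function

namespace Summit.AnomalousDissipation.AnomalousDissipation.Theorems.WindLineReachesCalm

open Literature.Analysis.FunctionSpaces Literature.Analysis.FunctionSpaces.Torus
open Literature.Analysis.FluidPDE Literature.Analysis.FluidPDE.Torus

variable {d : Type*} [Fintype d] {S : Finset (d → ℤ)}

/-! ## §1 The mean mode of the Galerkin field -/

/-- **The convection symbol has no mean mode** on transversal families: for `c` transversal on `S`,
`convectionCoeff S c c' 0 = ∑_{l + m = 0} 2πi (c_l · m) • c'_m = 0`, because `l = -m` and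
`c_{-m} · m = -(c_{-m} · (-m)) = 0`. [folklore] -/
theorem convectionCoeff_apply_zero {c c' : (d → ℤ) → EuclideanSpace ℂ d} (hc : IsTransversal S c) :
    convectionCoeff S c c' 0 = 0 := by
  rw [convectionCoeff_def]
  refine Finset.sum_eq_zero fun l hl => Finset.sum_eq_zero fun m _ => ?_
  split_ifs with h
  · have hm : m = -l := eq_neg_of_add_eq_zero_right h
    have ht : ∑ j, c l j * (m j : ℂ) = 0 := by
      have h0 := hc l hl
      subst hm
      simp only [Pi.neg_apply, Int.cast_neg, mul_neg, Finset.sum_neg_distrib, neg_eq_zero]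
      rw [← h0]
      exact Finset.sum_congr rfl fun j _ => mul_comm _ _
    rw [ht, mul_zero, zero_smul]
  · rfl

/-- **The Galerkin field has no mean mode on the phase space** (conservation of momentum): if `0 ∈ S`,
the force has no mean mode (`g 0 = 0`) and `c` is transversal, then `galerkinRHS S ν g c 0 = 0`
(the Stokes multiplier `ν·4π²|k|²` vanishes at `k = 0`, the Leray symbol is the identity there, and the
convection symbol has no mean mode). [folklore] -/
theorem galerkinRHS_apply_zero (ν : ℝ) (h0 : (0 : d → ℤ) ∈ S) {g c : ↥S → EuclideanSpace ℂ d}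
    (hg0 : g ⟨0, h0⟩ = 0) (hc : IsSolenoidalCoeff c) :
    galerkinRHS S ν g c ⟨0, h0⟩ = 0 := by
  rw [galerkinRHS_apply, galerkinField_def]
  have h1 : coeffExt S g 0 = 0 := by rw [coeffExt_of_mem g h0, hg0]
  have h2 : convectionCoeff S (coeffExt S c) (coeffExt S c) 0 = 0 :=
    convectionCoeff_apply_zero hc.isTransversal_coeffExt
  simp [freqNormSq_zero, h1, h2]

/-! ## §2 The energy identity in coordinates -/

/-- **Energy identity in coordinates** (Temam 1979, Ch. II (1.29), on the Fourier side): for `S`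
symmetric, `g` real and `c` in the Galerkin phase space,
`∑_k Re⟪c_k, galerkinRHS S ν g c k⟫ = -ν·4π² ∑_k |k|² ‖c_k‖² + ∑_k Re⟪g_k, c_k⟫`
(the tree's `sum_re_inner_galerkinRHS_self` with `‖∇u‖²` and `∫⟪G, u⟫` rewritten by Parseval).
The wind `c 0` enters neither term with a derivative: the wind does no work. [folklore] -/
theorem sum_re_inner_galerkinRHS_eq (ν : ℝ) (hS : ∀ k ∈ S, -k ∈ S)
    {g c : ↥S → EuclideanSpace ℂ d} (hg : IsRealCoeff g) (hc : c ∈ galerkinSubspace S) :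
    ∑ k : ↥S, (inner ℂ (c k) (galerkinRHS S ν g c k)).re =
      -(ν * (4 * Real.pi ^ 2 * ∑ k : ↥S, freqNormSq (k : d → ℤ) * ‖c k‖ ^ 2)) +
        ∑ k : ↥S, (inner ℂ (g k) (c k)).re := by
  classical
  have h := sum_re_inner_galerkinRHS_self ν hS hg hc
  rw [toReal_eGradNormSq_realTrigPoly hS (hc.1.isConjSymm_coeffExt hS),
    sum_coeffExt (fun k v => freqNormSq k * ‖v‖ ^ 2),
    integral_inner_realTrigPoly_realTrigPoly hS (hg.isConjSymm_coeffExt hS)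
      (hc.1.isConjSymm_coeffExt hS)] at h
  rw [h, ← Finset.sum_coe_sort S]
  congr 1
  exact Finset.sum_congr rfl fun k _ => by rw [coeffExt_coe, coeffExt_coe]

/-! ## §3 Coercivity off the mean mode and the a-priori bound -/

/-- `1 ≤ |k|²` for a nonzero frequency. [folklore] -/
theorem one_le_freqNormSq_of_ne_zero {k : d → ℤ} (hk : k ≠ 0) : (1 : ℝ) ≤ freqNormSq k := by
  obtain ⟨i, hi⟩ : ∃ i, k i ≠ 0 := Function.ne_iff.1 hk
  have hi1 : (1 : ℝ) ≤ (k i : ℝ) ^ 2 := by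
    have h' : (1 : ℤ) ≤ (k i) ^ 2 := by
      have := Int.one_le_abs hi
      nlinarith [sq_abs (k i)]
    exact_mod_cast h'
  exact hi1.trans (Finset.single_le_sum (f := fun j => (k j : ℝ) ^ 2)
    (fun j _ => sq_nonneg _) (Finset.mem_univ i))

/-- The calm energy is dominated by the enstrophy-type sum: `∑_{k≠0} ‖c_k‖² ≤ ∑_k |k|² ‖c_k‖²`. [folklore] -/
theorem calmEnergy_le_sum_freqNormSq_mul (c : ↥S → EuclideanSpace ℂ d) :
    ∑ k : ↥S, (if (k : d → ℤ) = 0 then 0 else ‖c k‖ ^ 2) ≤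
      ∑ k : ↥S, freqNormSq (k : d → ℤ) * ‖c k‖ ^ 2 := by
  refine Finset.sum_le_sum fun k _ => ?_
  split_ifs with hk
  · exact mul_nonneg (freqNormSq_nonneg _) (sq_nonneg _)
  · exact le_mul_of_one_le_left (sq_nonneg _) (one_le_freqNormSq_of_ne_zero hk)

/-- The force pairing only sees the calm part and is controlled by Cauchy–Schwarz:
`∑_k Re⟪g_k, c_k⟫ ≤ (∑ ‖g_k‖²)^{1/2} (∑_{k≠0} ‖c_k‖²)^{1/2}` when `g 0 = 0`. [folklore] -/
theorem sum_re_inner_le_sqrt_mul_sqrt (h0 : (0 : d → ℤ) ∈ S) {g : ↥S → EuclideanSpace ℂ d}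
    (hg0 : g ⟨0, h0⟩ = 0) (c : ↥S → EuclideanSpace ℂ d) :
    ∑ k : ↥S, (inner ℂ (g k) (c k)).re ≤
      Real.sqrt (∑ k : ↥S, ‖g k‖ ^ 2) *
        Real.sqrt (∑ k : ↥S, (if (k : d → ℤ) = 0 then 0 else ‖c k‖ ^ 2)) := by
  -- the calm truncation of `c`
  set c' : ↥S → EuclideanSpace ℂ d := fun k => if (k : d → ℤ) = 0 then 0 else c k with hc'
  have hgc : ∀ k : ↥S, (inner ℂ (g k) (c k)).re = (inner ℂ (g k) (c' k)).re := by
    intro k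
    by_cases hk : (k : d → ℤ) = 0
    · have hk' : k = ⟨0, h0⟩ := Subtype.ext hk
      rw [hk', hg0, inner_zero_left, inner_zero_left]
    · rw [hc']
      dsimp only
      rw [if_neg hk]
  have hnorm : ∀ k : ↥S, ‖c' k‖ ^ 2 = if (k : d → ℤ) = 0 then 0 else ‖c k‖ ^ 2 := by
    intro k
    rw [hc']
    dsimp only
    split_ifs
    · simp
    · rfl
  have h1 : ∑ k : ↥S, (inner ℂ (g k) (c' k)).re ≤ ∑ k : ↥S, ‖g k‖ * ‖c' k‖ :=
    Finset.sum_le_sum fun k _ => (Complex.re_le_norm _).trans (norm_inner_le_norm _ _)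
  rw [Finset.sum_congr rfl fun k _ => hgc k, ← Finset.sum_congr rfl fun k _ => hnorm k]
  refine h1.trans ?_
  rw [← Real.sqrt_mul (Finset.sum_nonneg fun k _ => sq_nonneg _)]
  refine Real.le_sqrt_of_sq_le ?_
  exact Finset.sum_mul_sq_le_sq_mul_sq _ _ _

/-- **Coercivity of the Galerkin field off the mean mode, uniformly in the wind.** For `S` symmetric
with `0 ∈ S`, `ν ≥ 0`, a real force vector `g` with `g 0 = 0`, and `c` in the Galerkin phase space,
`∑_k Re⟪c_k, galerkinRHS S ν g c k⟫ ≤ -(4π²ν) β + (∑‖g_k‖²)^{1/2} β^{1/2}`,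
`β = ∑_{k≠0} ‖c_k‖²` (energy identity, `|k|² ≥ 1` off the mean mode, Cauchy–Schwarz); the momentum `c 0`
does not appear. [folklore] -/
theorem sum_re_inner_galerkinRHS_le {ν : ℝ} (hν : 0 ≤ ν) (hS : ∀ k ∈ S, -k ∈ S)
    (h0 : (0 : d → ℤ) ∈ S) {g c : ↥S → EuclideanSpace ℂ d} (hg : IsRealCoeff g)
    (hg0 : g ⟨0, h0⟩ = 0) (hc : c ∈ galerkinSubspace S) :
    ∑ k : ↥S, (inner ℂ (c k) (galerkinRHS S ν g c k)).re ≤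
      -(4 * Real.pi ^ 2 * ν * ∑ k : ↥S, (if (k : d → ℤ) = 0 then 0 else ‖c k‖ ^ 2)) +
        Real.sqrt (∑ k : ↥S, ‖g k‖ ^ 2) *
          Real.sqrt (∑ k : ↥S, (if (k : d → ℤ) = 0 then 0 else ‖c k‖ ^ 2)) := by
  rw [sum_re_inner_galerkinRHS_eq ν hS hg hc]
  have h1 := calmEnergy_le_sum_freqNormSq_mul c
  have h2 := sum_re_inner_le_sqrt_mul_sqrt h0 hg0 c
  have h3 : ν * (4 * Real.pi ^ 2 * ∑ k : ↥S, (if (k : d → ℤ) = 0 then 0 else ‖c k‖ ^ 2)) ≤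
      ν * (4 * Real.pi ^ 2 * ∑ k : ↥S, freqNormSq (k : d → ℤ) * ‖c k‖ ^ 2) :=
    mul_le_mul_of_nonneg_left (mul_le_mul_of_nonneg_left h1 (by positivity)) hν
  linarith

/-- **A-priori bound at a windy steady state** (Temam 1979, Ch. II (1.30), with a free mean mode): if
moreover `ν > 0` and `galerkinRHS S ν g c = 0`, then `(∑_{k≠0} ‖c_k‖²)^{1/2} ≤ (∑ ‖g_k‖²)^{1/2} / (4π²ν)`,
whatever the momentum `c 0`. [folklore] -/
theorem sqrt_calmEnergy_le_of_galerkinRHS_eq_zero {ν : ℝ} (hν : 0 < ν) (hS : ∀ k ∈ S, -k ∈ S)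
    (h0 : (0 : d → ℤ) ∈ S) {g c : ↥S → EuclideanSpace ℂ d} (hg : IsRealCoeff g)
    (hg0 : g ⟨0, h0⟩ = 0) (hc : c ∈ galerkinSubspace S) (hz : galerkinRHS S ν g c = 0) :
    Real.sqrt (∑ k : ↥S, (if (k : d → ℤ) = 0 then 0 else ‖c k‖ ^ 2)) ≤
      Real.sqrt (∑ k : ↥S, ‖g k‖ ^ 2) / (4 * Real.pi ^ 2 * ν) := by
  set β : ℝ := ∑ k : ↥S, (if (k : d → ℤ) = 0 then 0 else ‖c k‖ ^ 2) with hβ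
  set γ : ℝ := ∑ k : ↥S, ‖g k‖ ^ 2 with hγ
  have hβ0 : 0 ≤ β := Finset.sum_nonneg fun k _ => by
    split_ifs
    · exact le_rfl
    · exact sq_nonneg _
  have hden : 0 < 4 * Real.pi ^ 2 * ν := by positivity
  have h := sum_re_inner_galerkinRHS_le hν.le hS h0 hg hg0 hc
  rw [hz] at h
  simp only [Pi.zero_apply, inner_zero_right, Complex.zero_re, Finset.sum_const_zero] at h
  rw [← hβ, ← hγ] at h
  -- `4π²ν β ≤ √γ √β`, hence `4π²ν √β ≤ √γ`
  rw [le_div_iff₀ hden]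
  by_cases hb : Real.sqrt β = 0
  · rw [hb, zero_mul]
    exact Real.sqrt_nonneg _
  have hbpos : 0 < Real.sqrt β := lt_of_le_of_ne (Real.sqrt_nonneg _) (Ne.symm hb)
  have h2 : 4 * Real.pi ^ 2 * ν * Real.sqrt β * Real.sqrt β ≤ Real.sqrt γ * Real.sqrt β := by
    rw [mul_assoc, Real.mul_self_sqrt hβ0]
    linarith
  calc Real.sqrt β * (4 * Real.pi ^ 2 * ν) = 4 * Real.pi ^ 2 * ν * Real.sqrt β := by ring
    _ ≤ Real.sqrt γ := le_of_mul_le_mul_right h2 hbpos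

/-- **Every calm coordinate of a windy steady state is bounded**: under the same hypotheses,
`‖c_k‖ ≤ (∑ ‖g_k‖²)^{1/2} / (4π²ν)` for every `k ≠ 0` in `S`. [folklore] -/
theorem norm_apply_le_of_galerkinRHS_eq_zero {ν : ℝ} (hν : 0 < ν) (hS : ∀ k ∈ S, -k ∈ S)
    (h0 : (0 : d → ℤ) ∈ S) {g c : ↥S → EuclideanSpace ℂ d} (hg : IsRealCoeff g)
    (hg0 : g ⟨0, h0⟩ = 0) (hc : c ∈ galerkinSubspace S) (hz : galerkinRHS S ν g c = 0)
    {k : ↥S} (hk : (k : d → ℤ) ≠ 0) :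
    ‖c k‖ ≤ Real.sqrt (∑ k : ↥S, ‖g k‖ ^ 2) / (4 * Real.pi ^ 2 * ν) := by
  refine le_trans ?_ (sqrt_calmEnergy_le_of_galerkinRHS_eq_zero hν hS h0 hg hg0 hc hz)
  refine Real.le_sqrt_of_sq_le ?_
  have : ‖c k‖ ^ 2 = if (k : d → ℤ) = 0 then 0 else ‖c k‖ ^ 2 := by rw [if_neg hk]
  rw [this]
  exact Finset.single_le_sum (f := fun k : ↥S => if (k : d → ℤ) = 0 then 0 else ‖c k‖ ^ 2)
    (fun k _ => by
      split_ifs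
      · exact le_rfl
      · exact sq_nonneg _) (Finset.mem_univ k)

end Summit.AnomalousDissipation.AnomalousDissipation.Theorems.WindLineReachesCalm

end
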